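import Summits.QuantumFields.YangMills.Theorems.LuscherReductionTwistedTraceScalingBTCoreFloor
import Summits.QuantumFields.YangMills.Theorems.FlatTubeReductionHaarSmallBall
import Summits.QuantumFields.YangMills.Theorems.FlatTubeReductionColourDisintegration
import HarnessLib

/-!
# Level sets of the kinetic defect in colour coordinates: `{kinDefect ≤ D}` lies in a box of quaternion balls of radius `3L(√D + 4a + b)`, a box of radius `ρ` lies in
# `{kinDefect ≤ |E|(2ρ + √2‖v̂‖ + √2‖v̂′‖)²}`, and the Haar volumes of both — polynomial in `√D`, no logarithm
# (tool for the log-free MOMENT analysis of the rate twin «ratepack-v3 / frozen fibres»; route `FlatTubeReduction`, crux K1 `NearFlatRatioLaw` stmt-QuantumFields-24720;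
# seat `ym-line-ftr-p1` g12; R2b1 RECORD rung — no summit statement is proved here)

WHY (memo `Cruxes/NearFlatRatioLaw/Lines/ratepack-v3-frozen-g12.md` §5.6 (v)).  The layer cake (`…GaussianLayerCake`) needs the VOLUME GROWTH `vol{N ≤ t} ≤ V(t+1)^m` and the
FLOOR `vol{N ≤ 1} ≥ v` of the Gaussian level `N = β·kinDefect` with `V/v = O_L(1)`.  In the colour coordinates `g = c·k` of `…ColourDisintegration` (`k_0 = 1`) the defect is
colour covariant (§1), its smallness bounds every edge jump (§2, lane A's `norm_edgeDefect_ge`), the torus path bound turns jumps into amplitudes of the RELATIVE field `k` (§3, no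
Faddeev–Popov pinning needed since `k_0 = 1`), so the level set of `k` lies in a box of quaternion balls whose Haar volume is polynomial (`haarReal_quatBall_le`, §4); conversely a
small box lies in a level set (lane A's `kinDefect_orthoTube_one_le`) with the floor `haarReal_quatBall_ge` (§5).
* `kinDefect_constMul` — `kinDefect U V (c·g) = kinDefect (c⁻¹Uc) V g`;
* `jump_le_of_kinDefect_le` — `kinDefect ≤ D`, `‖q(U_e) − 1‖ ≤ a`, `‖q(U_e) − q(V_e)‖ ≤ b` ⇒ every jump `≤ √D + 4a + b`; `amplitude_le_of_kinDefect_le` (`g_0 = 1` ⇒ amplitudes `≤ 3L(…)`);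
* ★ `kinLevelSet_subset_box`, ★ `pi_real_kinLevelSet_le` — `Haar^{Λ∖0}{k : kinDefect U V (colourJoin 0 (1,k)) ≤ D} ≤ ((π²/12)(3L(√D + 4a + b))³)^{|Λ|−1}`;
* ★ `box_subset_kinLevelSet`, ★ `pi_real_kinLevelSet_ge` — `Haar^{Λ∖0}{k : kinDefect (oT 1 v) (oT 1 v′) (colourJoin 0 (1,k)) ≤ |E|(2ρ + √2‖v̂‖ + √2‖v̂′‖)²} ≥ (ρ³/10)^{|Λ|−1}` (`0 < ρ ≤ 1`).
HONEST FRAMING: quaternion / measure bookkeeping; femto rung R2b1 (RECORD label); not infinite volume, not a gap, not Clay.  No defs, no named facts, no `sorry`.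
-/

set_option autoImplicit false

noncomputable section

open MeasureTheory Filter Topology Real Set
open scoped BigOperators ENNReal
open Literature.MathematicalPhysics.QuantumFieldTheory
open Literature.MathematicalPhysics.QuantumLattice

namespace Summit.QuantumFields.YangMills.Theorems.FemtoTransferGap.RateTube

open Summit.QuantumFields.YangMills.Theorems.FemtoTransferGap
open Summit.QuantumFields.YangMills.Theorems.FemtoTransferGap.TwoLattice
open Summit.QuantumFields.YangMills.Theorems.FemtoTransferGap.TwoLattice.ConstTube
open Summit.QuantumFields.YangMills.Theorems.FemtoTransferGap.TwoLattice.Avg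

variable {L : ℕ} [NeZero L]

/-! ## §1 Colour covariance of the kinetic defect -/

/-- `kinDefect U V (c·g) = kinDefect (c⁻¹Uc) V g` (`q(U)q(c)q(g_y) − q(c)q(g_x)q(V) = q(c)[q(c⁻¹Uc)q(g_y) − q(g_x)q(V)]`, `‖q(c)‖ = 1`). [folklore] -/
theorem kinDefect_constMul (U V : GaugeConfig 3 L SU2) (c : SU2) (g : Site 3 L → SU2) :
    kinDefect L U V (fun x => c * g x) = kinDefect L (fun e => c⁻¹ * U e * c) V g := by
  unfold kinDefect
  refine Finset.sum_congr rfl fun e _ => ?_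
  have hcc : su2Quat c * su2Quat c⁻¹ = 1 := by rw [← su2Quat_mul, mul_inv_cancel, su2Quat_one]
  have key : su2Quat (U e) * su2Quat (c * g (e.1.shift e.2)) - su2Quat (c * g e.1) * su2Quat (V e) =
      su2Quat c * (su2Quat (c⁻¹ * U e * c) * su2Quat (g (e.1.shift e.2)) - su2Quat (g e.1) * su2Quat (V e)) := by
    simp only [su2Quat_mul, mul_sub, ← mul_assoc, hcc, one_mul]
  rw [key, norm_mul, norm_su2Quat, one_mul]

/-! ## §2 Small defect ⇒ small jumps ⇒ (for a normalised field) small amplitudes -/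

/-- **Jumps from the defect**: `kinDefect U V g ≤ D`, `‖q(U_e) − 1‖ ≤ a`, `‖q(U_e) − q(V_e)‖ ≤ b` on all edges ⇒ every edge jump of `g` is `≤ √D + 4a + b`. [folklore] -/
theorem jump_le_of_kinDefect_le (U V : GaugeConfig 3 L SU2) (g : Site 3 L → SU2) {a b D : ℝ} (ha : ∀ e, ‖su2Quat (U e) - 1‖ ≤ a)
    (hb : ∀ e, ‖su2Quat (U e) - su2Quat (V e)‖ ≤ b) (hD : kinDefect L U V g ≤ D) (e : Edge 3 L) :
    ‖su2Quat (g (e.1.shift e.2)) - su2Quat (g e.1)‖ ≤ Real.sqrt D + 4 * a + b := by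
  have h1 := norm_edgeDefect_ge (U e) (V e) (g e.1) (g (e.1.shift e.2))
  have h2 : ‖su2Quat (U e) * su2Quat (g (e.1.shift e.2)) - su2Quat (g e.1) * su2Quat (V e)‖ ≤ Real.sqrt D := by
    have h := (sq_edgeDefect_le_kinDefect U V g e).trans hD
    rw [← Real.sqrt_sq (norm_nonneg (su2Quat (U e) * su2Quat (g (e.1.shift e.2)) - su2Quat (g e.1) * su2Quat (V e)))]
    exact Real.sqrt_le_sqrt h
  have ha0 : 0 ≤ a := (norm_nonneg _).trans (ha e)
  have htwo : ‖su2Quat (g e.1) - 1‖ ≤ 2 := (norm_sub_le _ _).trans (by rw [norm_su2Quat, norm_one]; norm_num)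
  have h3 : ‖su2Quat (U e) - 1‖ * ‖su2Quat (g e.1) - 1‖ ≤ a * 2 := mul_le_mul (ha e) htwo (norm_nonneg _) ha0
  linarith [hb e]

/-- **Amplitudes of a normalised field** (`g_0 = 1`): under the same hypotheses every `‖q(g_x) − 1‖ ≤ 3L(√D + 4a + b)` (torus path bound). [folklore] -/
theorem amplitude_le_of_kinDefect_le (U V : GaugeConfig 3 L SU2) {g : Site 3 L → SU2} (hg0 : g 0 = 1) {a b D : ℝ} (ha : ∀ e, ‖su2Quat (U e) - 1‖ ≤ a)
    (hb : ∀ e, ‖su2Quat (U e) - su2Quat (V e)‖ ≤ b) (hD : kinDefect L U V g ≤ D) (x : Site 3 L) :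
    ‖su2Quat (g x) - 1‖ ≤ 3 * L * (Real.sqrt D + 4 * a + b) := by
  have h := norm_su2Quat_sub_base_le (L := L) (jump_le_of_kinDefect_le U V g ha hb hD) x
  rwa [hg0, su2Quat_one] at h

/-! ## §3 ★ The level set of the relative field lies in a box; its volume -/

omit [NeZero L] in
/-- The normalised field `colourJoin 0 (1, k)` is `1` at the base site and `k_x` elsewhere. [folklore] -/
theorem colourJoin_one_apply_ne (k : {x : Site 3 L // ¬x = 0} → SU2) (x : {x : Site 3 L // ¬x = 0}) : colourJoin 0 (1, k) x.1 = k x := by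
  rw [colourJoin_apply_ne 0 _ x.2, one_mul]

/-- ★ **Level set ⊆ box**: `{k : kinDefect U V (colourJoin 0 (1,k)) ≤ D} ⊆ Π_x quatBall(3L(√D + 4a + b))`. [folklore] -/
theorem kinLevelSet_subset_box (U V : GaugeConfig 3 L SU2) {a b : ℝ} (ha : ∀ e, ‖su2Quat (U e) - 1‖ ≤ a) (hb : ∀ e, ‖su2Quat (U e) - su2Quat (V e)‖ ≤ b) (D : ℝ) :
    {k : {x : Site 3 L // ¬x = 0} → SU2 | kinDefect L U V (colourJoin 0 (1, k)) ≤ D} ⊆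
      Set.pi Set.univ fun _ : {x : Site 3 L // ¬x = 0} => quatBall (3 * L * (Real.sqrt D + 4 * a + b)) := by
  intro k hk x _
  have h := amplitude_le_of_kinDefect_le U V (g := colourJoin 0 (1, k)) (colourJoin_apply_self 0 _) ha hb hk x.1
  rw [colourJoin_one_apply_ne] at h
  exact h

/-- The relative-field level set is measurable. [folklore] -/
theorem measurableSet_kinLevelSet (U V : GaugeConfig 3 L SU2) (D : ℝ) :
    MeasurableSet {k : {x : Site 3 L // ¬x = 0} → SU2 | kinDefect L U V (colourJoin 0 (1, k)) ≤ D} := by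
  have hcont : Continuous fun g : Site 3 L → SU2 => kinDefect L U V g := by
    unfold kinDefect
    have hq := Literature.MathematicalPhysics.QuantumFieldTheory.Balaban1983to89.T4HaarSU2Translate.continuous_su2Quat
    refine continuous_finsetSum _ fun e _ => ?_
    have h1 : Continuous fun g : Site 3 L → SU2 => su2Quat (g (e.1.shift e.2)) := hq.comp (continuous_apply (e.1.shift e.2))
    have h2 : Continuous fun g : Site 3 L → SU2 => su2Quat (g e.1) := hq.comp (continuous_apply e.1)
    exact ((continuous_const.mul h1).sub (h2.mul continuous_const)).norm.pow 2
  have hj : Measurable fun k : {x : Site 3 L // ¬x = 0} → SU2 => colourJoin (L := L) 0 (1, k) :=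
    (measurable_colourJoin 0).comp (measurable_const.prodMk measurable_id)
  exact measurableSet_le (hcont.measurable.comp hj) measurable_const

/-- The Haar volume of a box of equal quaternion balls. [folklore] -/
theorem pi_real_box (ρ : ℝ) :
    (Measure.pi fun _ : {x : Site 3 L // ¬x = 0} => haarProbability SU2).real (Set.pi Set.univ fun _ : {x : Site 3 L // ¬x = 0} => quatBall ρ) =
      (haarProbability SU2).real (quatBall ρ) ^ Fintype.card {x : Site 3 L // ¬x = 0} := by
  rw [measureReal_def, Measure.pi_pi, Finset.prod_const, Finset.card_univ, ENNReal.toReal_pow, measureReal_def]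

/-- ★ **Volume growth of the kinetic level set**: `Haar^{Λ∖0}{k : kinDefect U V (colourJoin 0 (1,k)) ≤ D} ≤ ((π²/12)·(3L(√D + 4a + b))³)^{|Λ|−1}` — polynomial in `√D`.
[folklore] -/
theorem pi_real_kinLevelSet_le (U V : GaugeConfig 3 L SU2) {a b : ℝ} (ha : ∀ e, ‖su2Quat (U e) - 1‖ ≤ a) (hb : ∀ e, ‖su2Quat (U e) - su2Quat (V e)‖ ≤ b)
    (hb0 : 0 ≤ b) (D : ℝ) :
    (Measure.pi fun _ : {x : Site 3 L // ¬x = 0} => haarProbability SU2).real {k : {x : Site 3 L // ¬x = 0} → SU2 | kinDefect L U V (colourJoin 0 (1, k)) ≤ D} ≤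
      (π ^ 2 / 12 * (3 * L * (Real.sqrt D + 4 * a + b)) ^ 3) ^ Fintype.card {x : Site 3 L // ¬x = 0} := by
  have ha0 : 0 ≤ a := (norm_nonneg _).trans (ha default)
  have hR : 0 ≤ 3 * (L : ℝ) * (Real.sqrt D + 4 * a + b) := by positivity
  calc (Measure.pi fun _ : {x : Site 3 L // ¬x = 0} => haarProbability SU2).real {k : {x : Site 3 L // ¬x = 0} → SU2 | kinDefect L U V (colourJoin 0 (1, k)) ≤ D}
      ≤ (Measure.pi fun _ : {x : Site 3 L // ¬x = 0} => haarProbability SU2).real (Set.pi Set.univ fun _ : {x : Site 3 L // ¬x = 0} => quatBall (3 * L * (Real.sqrt D + 4 * a + b))) :=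
        measureReal_mono (kinLevelSet_subset_box U V ha hb D)
    _ = (haarProbability SU2).real (quatBall (3 * L * (Real.sqrt D + 4 * a + b))) ^ Fintype.card {x : Site 3 L // ¬x = 0} := pi_real_box _
    _ ≤ (π ^ 2 / 12 * (3 * L * (Real.sqrt D + 4 * a + b)) ^ 3) ^ Fintype.card {x : Site 3 L // ¬x = 0} :=
        pow_le_pow_left₀ measureReal_nonneg (haarReal_quatBall_le hR) _

/-! ## §4 ★ A small box lies in a level set of the vacuum pair; the floor -/

/-- ★ **Box ⊆ level set** at the vacuum pair: for capped `v, v′` and `ρ ≥ 0`, `Π_x quatBall ρ ⊆ {k : kinDefect (oT 1 v) (oT 1 v′) (colourJoin 0 (1,k)) ≤ |E|(2ρ + √2‖v̂‖ + √2‖v̂′‖)²}`.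
[folklore] -/
theorem box_subset_kinLevelSet {v v' : Edge 3 L → Fin 3 → ℝ} (hv1 : ∀ e, ∑ a, v e a ^ 2 ≤ 1) (hv'1 : ∀ e, ∑ a, v' e a ^ 2 ≤ 1) {ρ : ℝ} (hρ : 0 ≤ ρ) :
    (Set.pi Set.univ fun _ : {x : Site 3 L // ¬x = 0} => quatBall ρ) ⊆
      {k : {x : Site 3 L // ¬x = 0} → SU2 | kinDefect L (orthoTube L 1 v) (orthoTube L 1 v') (colourJoin 0 (1, k)) ≤
        (Fintype.card (Edge 3 L) : ℝ) * (2 * ρ + Real.sqrt 2 * ‖linkEmbed L v‖ + Real.sqrt 2 * ‖linkEmbed L v'‖) ^ 2} := by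
  intro k hk
  have hg : colourJoin 0 (1, k) ∈ gaugeCore L ρ := by
    intro x
    by_cases hx : x = 0
    · subst hx; rw [colourJoin_apply_self, su2Quat_one, sub_self, norm_zero]; exact hρ
    · have h := hk ⟨x, hx⟩ (Set.mem_univ _)
      rw [colourJoin_apply_ne 0 _ hx, one_mul]; exact h
  exact kinDefect_orthoTube_one_le hv1 hv'1 hg

/-- ★ **Floor of the kinetic level set**: for capped `v, v′` and `0 < ρ ≤ 1`,
`Haar^{Λ∖0}{k : kinDefect (oT 1 v) (oT 1 v′) (colourJoin 0 (1,k)) ≤ |E|(2ρ + √2‖v̂‖ + √2‖v̂′‖)²} ≥ (ρ³/10)^{|Λ|−1}`. [folklore] -/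
theorem pi_real_kinLevelSet_ge {v v' : Edge 3 L → Fin 3 → ℝ} (hv1 : ∀ e, ∑ a, v e a ^ 2 ≤ 1) (hv'1 : ∀ e, ∑ a, v' e a ^ 2 ≤ 1) {ρ : ℝ} (hρ : 0 < ρ) (hρ1 : ρ ≤ 1) :
    (ρ ^ 3 / 10) ^ Fintype.card {x : Site 3 L // ¬x = 0} ≤
      (Measure.pi fun _ : {x : Site 3 L // ¬x = 0} => haarProbability SU2).real
        {k : {x : Site 3 L // ¬x = 0} → SU2 | kinDefect L (orthoTube L 1 v) (orthoTube L 1 v') (colourJoin 0 (1, k)) ≤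
          (Fintype.card (Edge 3 L) : ℝ) * (2 * ρ + Real.sqrt 2 * ‖linkEmbed L v‖ + Real.sqrt 2 * ‖linkEmbed L v'‖) ^ 2} := by
  calc (ρ ^ 3 / 10) ^ Fintype.card {x : Site 3 L // ¬x = 0} ≤ (haarProbability SU2).real (quatBall ρ) ^ Fintype.card {x : Site 3 L // ¬x = 0} :=
        pow_le_pow_left₀ (by positivity) (haarReal_quatBall_ge hρ hρ1) _
    _ = (Measure.pi fun _ : {x : Site 3 L // ¬x = 0} => haarProbability SU2).real (Set.pi Set.univ fun _ : {x : Site 3 L // ¬x = 0} => quatBall ρ) := (pi_real_box ρ).symm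
    _ ≤ _ := measureReal_mono (box_subset_kinLevelSet hv1 hv'1 hρ.le)

end Summit.QuantumFields.YangMills.Theorems.FemtoTransferGap.RateTube

end
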